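import Literature.NumberTheory.Transcendental.QuadraticRelationsLogarithmsSec6Cat
import HarnessLib

/-!
# Roy–Waldschmidt 1997, §6 (ii): the functions on `Ob(𝒞)` and their additivity

D. Roy, M. Waldschmidt, Ann. Sci. ÉNS (4) 30 (1997) 753–796, §6 (ii), pp. 786–787: for an object
`X = (d₀, d₁, W, Y, Y_a)` of `𝒞`,
`d₀(X) = d₀`, `d₁(X) = d₁`, `d(X) = d₀ + d₁`, `ℓ₀(X) = dim_K W`, `ℓ₁(X) = rang_ℤ Y`,
`ℓ_a(X) = rang_ℤ Y_a`, `n(X) = dim_ℂ(ℂW + ℂY)`, `κ(X) = rang_ℤ(Y ∩ (0 × ωℤ^{d₁}))`,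
`κ_a(X) = rang_ℤ(Y_a ∩ (0 × ωℤ^{d₁}))`, `ω = 2πi`.  "Les fonctions `d₀, d₁, d, ℓ₀, ℓ₁` et `ℓ_a`
sont additives … la fonction `n` est sur-additive … la fonction `κ` est sous-additive … De même,
la fonction `κ_a` est elle-aussi sous-additive" — additivity referring to exact triples
`X* →f X →g X'` (`f` a kernel (6.2), `g` a cokernel (6.3), `im f = ker g`).

This file DEFINES the nine functions (`RWObj.dd₀`, …, `RWObj.kapA`) and PROVES these
(in)equalities for the relation `Exact` of `…Sec6Cat.lean`, together with the elementary bounds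
(`ℓ₀ ≤ n`, `ℓ_a ≤ ℓ₁`, `κ_a ≤ κ ≤ d₁`, `n ≤ d`, `n = 0 → ℓ₁ = 0`) used in Lemme 6.3.
No named facts.

## References

* [RoyWaldschmidt1997ENS] D. Roy, M. Waldschmidt, Ann. Sci. ÉNS (4) 30 (1997) 753–796, §6 (ii),
  pp. 786–787 (read on the rendered scan).
-/

noncomputable section

open Complex IntermediateField Module Submodule

namespace Literature.NumberTheory.Transcendental

namespace RoyWaldschmidt1997

open LiePresentation

variable {K : IntermediateField ℚ ℂ}

/-! ### The lattice `0 × ωℤ^{d₁}` and the nine functions -/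

/-- The subgroup `0 × ωℤ^{d₁} ⊆ ℂ^{d₀} × ℂ^{d₁}`, `ω = 2πi` (the kernel of
`exp_G : ℂ^{d₀} × ℂ^{d₁} → 𝐆_a^{d₀}(ℂ) × 𝐆_m^{d₁}(ℂ)`). [cite: RoyWaldschmidt1997ENS, §6 (ii), p. 786] -/
def omegaLattice (d₀ d₁ : ℕ) : Submodule ℤ ((Fin d₀ → ℂ) × (Fin d₁ → ℂ)) where
  carrier := {p | p.1 = 0 ∧ ∀ j, ∃ m : ℤ, p.2 j = m * (2 * Real.pi * I)}
  add_mem' := by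
    rintro p q ⟨hp1, hp2⟩ ⟨hq1, hq2⟩
    refine ⟨by simp [hp1, hq1], fun j => ?_⟩
    obtain ⟨a, ha⟩ := hp2 j; obtain ⟨b, hb⟩ := hq2 j
    exact ⟨a + b, by simp only [Prod.snd_add, Pi.add_apply, ha, hb]; push_cast; ring⟩
  zero_mem' := ⟨rfl, fun j => ⟨0, by simp⟩⟩
  smul_mem' := by
    rintro c p ⟨hp1, hp2⟩
    refine ⟨by rw [Prod.smul_fst, hp1, smul_zero], fun j => ?_⟩
    obtain ⟨a, ha⟩ := hp2 j
    refine ⟨c * a, ?_⟩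
    rw [Prod.smul_snd, Pi.smul_apply, ha, zsmul_eq_mul]
    push_cast; ring

/-- Membership in `0 × ωℤ^{d₁}`. [folklore] -/
theorem mem_omegaLattice {d₀ d₁ : ℕ} {p : (Fin d₀ → ℂ) × (Fin d₁ → ℂ)} :
    p ∈ omegaLattice d₀ d₁ ↔ p.1 = 0 ∧ ∀ j, ∃ m : ℤ, p.2 j = m * (2 * Real.pi * I) := Iff.rfl

namespace RWObj

/-- `d₀(X)`. [cite: RoyWaldschmidt1997ENS, §6 (ii), p. 786] -/
def dd₀ (X : RWObj K) : ℕ := X.d₀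
/-- `d₁(X)`. [cite: RoyWaldschmidt1997ENS, §6 (ii), p. 786] -/
def dd₁ (X : RWObj K) : ℕ := X.d₁
/-- `d(X) = d₀ + d₁`. [cite: RoyWaldschmidt1997ENS, §6 (ii), p. 786] -/
def dd (X : RWObj K) : ℕ := X.d₀ + X.d₁
/-- `ℓ₀(X) = dim_K(W)`. [cite: RoyWaldschmidt1997ENS, §6 (ii), p. 786] -/
def ell₀ (X : RWObj K) : ℕ := Module.finrank K X.W
/-- `ℓ₁(X) = rang_ℤ(Y)`. [cite: RoyWaldschmidt1997ENS, §6 (ii), p. 786] -/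
def ell₁ (X : RWObj K) : ℕ := Module.finrank ℤ X.Y
/-- `ℓ_a(X) = rang_ℤ(Y_a)`. [cite: RoyWaldschmidt1997ENS, §6 (ii), p. 786] -/
def ellA (X : RWObj K) : ℕ := Module.finrank ℤ X.Ya
/-- `n(X) = dim_ℂ(ℂW + ℂY)`. [cite: RoyWaldschmidt1997ENS, §6 (ii), p. 786] -/
def nn (X : RWObj K) : ℕ :=
  Module.finrank ℂ (span ℂ ((X.W : Set ((Fin X.d₀ → ℂ) × (Fin X.d₁ → ℂ))) ∪ (X.Y : Set _)))
/-- `κ(X) = rang_ℤ(Y ∩ (0 × ωℤ^{d₁}))`. [cite: RoyWaldschmidt1997ENS, §6 (ii), p. 786] -/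
def kap (X : RWObj K) : ℕ := Module.finrank ℤ ↥(X.Y ⊓ omegaLattice X.d₀ X.d₁)
/-- `κ_a(X) = rang_ℤ(Y_a ∩ (0 × ωℤ^{d₁}))`. [cite: RoyWaldschmidt1997ENS, §6 (ii), p. 786] -/
def kapA (X : RWObj K) : ℕ := Module.finrank ℤ ↥(X.Ya ⊓ omegaLattice X.d₀ X.d₁)

end RWObj

/-! ### Finiteness -/

namespace RWObj

set_option synthInstance.maxHeartbeats 200000 in
/-- `W ⊆ K^d` is finite-dimensional over `K` (it embeds `K`-linearly into `K^{d₀ ⊕ d₁}`).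
[folklore] -/
theorem finite_W (X : RWObj K) : Module.Finite K X.W := by
  let e : ((Fin X.d₀ → ℂ) × (Fin X.d₁ → ℂ)) ≃ₗ[ℂ] (Fin X.d₀ ⊕ Fin X.d₁ → ℂ) :=
    (LinearEquiv.sumArrowLequivProdArrow (Fin X.d₀) (Fin X.d₁) ℂ ℂ).symm
  have he1 : ∀ (v : (Fin X.d₀ → ℂ) × (Fin X.d₁ → ℂ)) x, e v (Sum.inl x) = v.1 x := fun _ _ => rfl
  have he2 : ∀ (v : (Fin X.d₀ → ℂ) × (Fin X.d₁ → ℂ)) x, e v (Sum.inr x) = v.2 x := fun _ _ => rfl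
  have hcoord : ∀ (w : X.W) (x : Fin X.d₀ ⊕ Fin X.d₁), e (w : (Fin X.d₀ → ℂ) × (Fin X.d₁ → ℂ)) x ∈ K := by
    intro w x
    obtain ⟨h1, h2⟩ := X.hW _ w.2
    cases x with
    | inl x => rw [he1]; exact h1 x
    | inr x => rw [he2]; exact h2 x
  let φ : X.W →ₗ[K] (Fin X.d₀ ⊕ Fin X.d₁ → K) :=
    { toFun := fun w x => ⟨e (w : (Fin X.d₀ → ℂ) × (Fin X.d₁ → ℂ)) x, hcoord w x⟩
      map_add' := fun w w' => by
        funext x; apply Subtype.ext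
        show e (((w + w' : X.W) : (Fin X.d₀ → ℂ) × (Fin X.d₁ → ℂ))) x = e (w : _) x + e (w' : _) x
        rw [Submodule.coe_add, map_add]; rfl
      map_smul' := fun c w => by
        funext x; apply Subtype.ext
        show e (((c • w : X.W) : (Fin X.d₀ → ℂ) × (Fin X.d₁ → ℂ))) x = (c : ℂ) * e (w : _) x
        rw [Submodule.coe_smul, IntermediateField.smul_def, map_smul]; rfl }
  have hφ : Function.Injective φ := by
    intro w w' h
    apply Subtype.ext
    apply e.injective
    funext x
    have := congrFun h x
    exact congrArg Subtype.val this
  exact Module.Finite.of_injective φ hφ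

/-- `Y` is a finitely generated `ℤ`-module. [folklore] -/
theorem finite_Y (X : RWObj K) : Module.Finite ℤ X.Y := Module.Finite.iff_fg.mpr X.hYfg

/-- `Y_a` is a finitely generated `ℤ`-module. [folklore] -/
theorem finite_Ya (X : RWObj K) : Module.Finite ℤ X.Ya := by
  haveI := X.finite_Y
  exact Module.Finite.of_injective (Submodule.inclusion X.hYa) (Submodule.inclusion_injective X.hYa)

/-- `Y_a` is finitely generated. [folklore] -/
theorem fg_Ya (X : RWObj K) : X.Ya.FG := by
  haveI := X.finite_Ya
  exact Module.Finite.iff_fg.mp inferInstance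

end RWObj

/-! ### Rank bookkeeping -/

/-- `dim (p.map g) + dim (p ∩ ker g) = dim p` over a field, `p` finite-dimensional. [folklore] -/
theorem finrank_map_add_finrank_inf_ker_field {F M N : Type*} [Field F] [AddCommGroup M] [Module F M]
    [AddCommGroup N] [Module F N] (p : Submodule F M) [FiniteDimensional F p] (g : M →ₗ[F] N) :
    Module.finrank F ↥(p.map g) + Module.finrank F ↥(p ⊓ LinearMap.ker g) = Module.finrank F p := by
  have h := LinearMap.finrank_range_add_finrank_ker (g.comp p.subtype)
  rw [LinearMap.range_comp, Submodule.range_subtype, LinearMap.ker_comp] at h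
  rw [← h]
  congr 1
  have e1 : ((LinearMap.ker g).comap p.subtype).map p.subtype = p ⊓ LinearMap.ker g :=
    Submodule.map_comap_subtype _ _
  exact (LinearEquiv.finrank_eq ((Submodule.equivMapOfInjective _ p.injective_subtype _).trans
    (LinearEquiv.ofEq _ _ e1))).symm

/-- `rang (Y.map g) + rang (Y ∩ ker g) = rang Y` for a finitely generated `ℤ`-submodule.
[folklore] -/
theorem finrank_map_add_finrank_inf_ker_int {M N : Type*} [AddCommGroup M] [AddCommGroup N]
    (Y : Submodule ℤ M) (hY : Y.FG) (g : M →ₗ[ℤ] N) :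
    Module.finrank ℤ ↥(Y.map g) + Module.finrank ℤ ↥(Y ⊓ LinearMap.ker g) = Module.finrank ℤ ↥Y := by
  haveI : Module.Finite ℤ Y := Module.Finite.iff_fg.mpr hY
  have h1 : Module.finrank ℤ (↥Y ⧸ (LinearMap.ker g).comap Y.subtype) +
      Module.finrank ℤ ↥((LinearMap.ker g).comap Y.subtype) = Module.finrank ℤ ↥Y :=
    Submodule.finrank_quotient_add_finrank _
  rw [← h1]
  congr 1
  · let ψ : ↥Y →ₗ[ℤ] N := g.comp Y.subtype
    have hker : LinearMap.ker ψ = (LinearMap.ker g).comap Y.subtype := by rw [LinearMap.ker_comp]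
    have hrange : LinearMap.range ψ = Y.map g := by rw [LinearMap.range_comp, Submodule.range_subtype]
    have e := (Submodule.quotEquivOfEq _ _ hker).symm.trans (ψ.quotKerEquivRange.trans
      (LinearEquiv.ofEq _ _ hrange))
    exact (LinearEquiv.finrank_eq e).symm
  · have e1 : ((LinearMap.ker g).comap Y.subtype).map Y.subtype = Y ⊓ LinearMap.ker g :=
      Submodule.map_comap_subtype _ _
    exact (LinearEquiv.finrank_eq ((Submodule.equivMapOfInjective _ Y.injective_subtype _).trans
      (LinearEquiv.ofEq _ _ e1))).symm

/-- `rang A ≤ rang B` for `A ≤ B`, `B` finitely generated over `ℤ`. [folklore] -/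
theorem finrank_le_of_le_fg {M : Type*} [AddCommGroup M] {A B : Submodule ℤ M} (hAB : A ≤ B) (hB : B.FG) :
    Module.finrank ℤ A ≤ Module.finrank ℤ B := by
  haveI : Module.Finite ℤ B := Module.Finite.iff_fg.mpr hB
  exact LinearMap.finrank_le_finrank_of_injective (f := Submodule.inclusion hAB) (Submodule.inclusion_injective hAB)

/-- The range of a `K`-scalar-restricted map. [folklore] -/
theorem range_restrictScalars_K {d₀ d₁ d₀' d₁' : ℕ}
    (f : ((Fin d₀ → ℂ) × (Fin d₁ → ℂ)) →ₗ[ℂ] ((Fin d₀' → ℂ) × (Fin d₁' → ℂ))) :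
    LinearMap.range (f.restrictScalars K) = (LinearMap.range f).restrictScalars K :=
  Submodule.ext fun _ => Iff.rfl

/-- The range of a `ℤ`-scalar-restricted map. [folklore] -/
theorem range_restrictScalars_int {d₀ d₁ d₀' d₁' : ℕ}
    (f : ((Fin d₀ → ℂ) × (Fin d₁ → ℂ)) →ₗ[ℂ] ((Fin d₀' → ℂ) × (Fin d₁' → ℂ))) :
    LinearMap.range (f.restrictScalars ℤ) = (LinearMap.range f).restrictScalars ℤ :=
  Submodule.ext fun _ => Iff.rfl

/-! ### Additivity of `d₀, d₁, d` -/

/-- Componentwise exactness of an exact triple in block form. [folklore] -/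
theorem exact_blocks {d₀s d₁s d₀ d₁ d₀' d₁' : ℕ}
    {f : ((Fin d₀s → ℂ) × (Fin d₁s → ℂ)) →ₗ[ℂ] ((Fin d₀ → ℂ) × (Fin d₁ → ℂ))}
    {g : ((Fin d₀ → ℂ) × (Fin d₁ → ℂ)) →ₗ[ℂ] ((Fin d₀' → ℂ) × (Fin d₁' → ℂ))}
    {f₀ : (Fin d₀s → ℂ) →ₗ[ℂ] (Fin d₀ → ℂ)} {f₁ : (Fin d₁s → ℂ) →ₗ[ℂ] (Fin d₁ → ℂ)}
    {g₀ : (Fin d₀ → ℂ) →ₗ[ℂ] (Fin d₀' → ℂ)} {g₁ : (Fin d₁ → ℂ) →ₗ[ℂ] (Fin d₁' → ℂ)}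
    (hf : ∀ p, f p = (f₀ p.1, f₁ p.2)) (hg : ∀ p, g p = (g₀ p.1, g₁ p.2))
    (h : LinearMap.range f = LinearMap.ker g) :
    LinearMap.range f₀ = LinearMap.ker g₀ ∧ LinearMap.range f₁ = LinearMap.ker g₁ := by
  constructor
  · ext u
    constructor
    · rintro ⟨us, rfl⟩
      have : f (us, 0) ∈ LinearMap.ker g := by rw [← h]; exact ⟨_, rfl⟩
      rw [LinearMap.mem_ker, hg, hf, Prod.mk_eq_zero] at this
      simpa using this.1
    · intro hu
      have : ((u, 0) : (Fin d₀ → ℂ) × (Fin d₁ → ℂ)) ∈ LinearMap.ker g := by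
        rw [LinearMap.mem_ker, hg, Prod.mk_eq_zero]; exact ⟨hu, by simp⟩
      rw [← h] at this
      obtain ⟨p, hp⟩ := this
      rw [hf, Prod.mk.injEq] at hp
      exact ⟨p.1, hp.1⟩
  · ext v
    constructor
    · rintro ⟨vs, rfl⟩
      have : f (0, vs) ∈ LinearMap.ker g := by rw [← h]; exact ⟨_, rfl⟩
      rw [LinearMap.mem_ker, hg, hf, Prod.mk_eq_zero] at this
      simpa using this.2
    · intro hv
      have : ((0, v) : (Fin d₀ → ℂ) × (Fin d₁ → ℂ)) ∈ LinearMap.ker g := by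
        rw [LinearMap.mem_ker, hg, Prod.mk_eq_zero]; exact ⟨by simp, hv⟩
      rw [← h] at this
      obtain ⟨p, hp⟩ := this
      rw [hf, Prod.mk.injEq] at hp
      exact ⟨p.2, hp.2⟩

/-- Dimension count for `ℂ^s →f₀ ℂ^d →g₀ ℂ^{d'}` exact with `f₀` injective, `g₀` surjective. [folklore] -/
theorem dim_add_of_exact {s d d' : ℕ} (f₀ : (Fin s → ℂ) →ₗ[ℂ] (Fin d → ℂ)) (g₀ : (Fin d → ℂ) →ₗ[ℂ] (Fin d' → ℂ))
    (hf : Function.Injective f₀) (hg : Function.Surjective g₀) (h : LinearMap.range f₀ = LinearMap.ker g₀) :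
    d = s + d' := by
  have h1 := LinearMap.finrank_range_add_finrank_ker g₀
  rw [LinearMap.range_eq_top.mpr hg, finrank_top, Module.finrank_fin_fun, Module.finrank_fin_fun, ← h,
    LinearMap.finrank_range_of_inj hf, Module.finrank_fin_fun] at h1
  omega

/-- The blocks of an injective block map are injective; of a surjective one, surjective. [folklore] -/
theorem block_injective {d₀s d₁s d₀ d₁ : ℕ}
    {f : ((Fin d₀s → ℂ) × (Fin d₁s → ℂ)) →ₗ[ℂ] ((Fin d₀ → ℂ) × (Fin d₁ → ℂ))}
    {f₀ : (Fin d₀s → ℂ) →ₗ[ℂ] (Fin d₀ → ℂ)} {f₁ : (Fin d₁s → ℂ) →ₗ[ℂ] (Fin d₁ → ℂ)}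
    (hf : ∀ p, f p = (f₀ p.1, f₁ p.2)) (hinj : Function.Injective f) :
    Function.Injective f₀ ∧ Function.Injective f₁ := by
  refine ⟨fun u u' huu => ?_, fun v v' hvv => ?_⟩
  · have := @hinj (u, 0) (u', 0) (by rw [hf, hf]; simp [huu])
    simpa using this
  · have := @hinj (0, v) (0, v') (by rw [hf, hf]; simp [hvv])
    simpa using this

/-- The blocks of a surjective block map are surjective. [folklore] -/
theorem block_surjective {d₀ d₁ d₀' d₁' : ℕ}
    {g : ((Fin d₀ → ℂ) × (Fin d₁ → ℂ)) →ₗ[ℂ] ((Fin d₀' → ℂ) × (Fin d₁' → ℂ))}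
    {g₀ : (Fin d₀ → ℂ) →ₗ[ℂ] (Fin d₀' → ℂ)} {g₁ : (Fin d₁ → ℂ) →ₗ[ℂ] (Fin d₁' → ℂ)}
    (hg : ∀ p, g p = (g₀ p.1, g₁ p.2)) (hsurj : Function.Surjective g) :
    Function.Surjective g₀ ∧ Function.Surjective g₁ := by
  refine ⟨fun u' => ?_, fun v' => ?_⟩
  · obtain ⟨p, hp⟩ := hsurj (u', 0)
    exact ⟨p.1, by have := congrArg Prod.fst hp; rwa [hg] at this⟩
  · obtain ⟨p, hp⟩ := hsurj (0, v')
    exact ⟨p.2, by have := congrArg Prod.snd hp; rwa [hg] at this⟩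

/-- **`d₀` and `d₁` are additive on exact triples.** [cite: RoyWaldschmidt1997ENS, §6 (ii), p. 786] -/
theorem Exact.dd₀_add {Xs X X' : RWObj K} (h : Exact Xs X X') :
    X.dd₀ = Xs.dd₀ + X'.dd₀ ∧ X.dd₁ = Xs.dd₁ + X'.dd₁ := by
  obtain ⟨f, g, ⟨⟨hfs, -, -, -⟩, hfinj, -, -, -⟩, ⟨⟨hgs, -, -, -⟩, hgsurj, -, -, -⟩, hrange⟩ := h
  obtain ⟨f₀, f₁, -, -, hfap, -, -⟩ := hfs.exists_block
  obtain ⟨g₀, g₁, -, -, hgap, -, -⟩ := hgs.exists_block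
  obtain ⟨h0, h1⟩ := exact_blocks hfap hgap hrange
  obtain ⟨hf₀, hf₁⟩ := block_injective hfap hfinj
  obtain ⟨hg₀, hg₁⟩ := block_surjective hgap hgsurj
  exact ⟨dim_add_of_exact f₀ g₀ hf₀ hg₀ h0, dim_add_of_exact f₁ g₁ hf₁ hg₁ h1⟩

/-- `d` is additive. [cite: RoyWaldschmidt1997ENS, §6 (ii), p. 786] -/
theorem Exact.dd_add {Xs X X' : RWObj K} (h : Exact Xs X X') : X.dd = Xs.dd + X'.dd := by
  obtain ⟨h0, h1⟩ := h.dd₀_add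
  simp only [RWObj.dd, RWObj.dd₀, RWObj.dd₁] at *
  omega

/-! ### Additivity of `ℓ₀, ℓ₁, ℓ_a` -/

/-- **`ℓ₀ = dim_K W` is additive** (`0 → W* → W → W' → 0`). [cite: RoyWaldschmidt1997ENS, §6 (ii), p. 786] -/
theorem Exact.ell₀_add {Xs X X' : RWObj K} (h : Exact Xs X X') : X.ell₀ = Xs.ell₀ + X'.ell₀ := by
  obtain ⟨f, g, ⟨-, hfinj, hW, -, -⟩, ⟨-, -, hW', -, -⟩, hrange⟩ := h
  simp only [RWObj.ell₀]
  haveI := X.finite_W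
  have h1 := finrank_map_add_finrank_inf_ker_field X.W (g.restrictScalars K)
  rw [hW'] at h1
  have h2 : X.W ⊓ LinearMap.ker (g.restrictScalars K) = Xs.W.map (f.restrictScalars K) := by
    rw [hW, Submodule.map_comap_eq, range_restrictScalars_K, LinearMap.ker_restrictScalars, hrange, inf_comm]
  rw [h2, finrank_map_of_injective _ (show Function.Injective (f.restrictScalars K) from hfinj)] at h1
  omega

/-- **`ℓ₁ = rang_ℤ Y` is additive** (`0 → Y* → Y → Y' → 0`). [cite: RoyWaldschmidt1997ENS, §6 (ii), pp. 786–787] -/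
theorem Exact.ell₁_add {Xs X X' : RWObj K} (h : Exact Xs X X') : X.ell₁ = Xs.ell₁ + X'.ell₁ := by
  obtain ⟨f, g, ⟨-, hfinj, -, hY, -⟩, ⟨-, -, -, hY', -⟩, hrange⟩ := h
  simp only [RWObj.ell₁]
  have h1 := finrank_map_add_finrank_inf_ker_int X.Y X.hYfg (g.restrictScalars ℤ)
  rw [hY'] at h1
  have h2 : X.Y ⊓ LinearMap.ker (g.restrictScalars ℤ) = Xs.Y.map (f.restrictScalars ℤ) := by
    rw [hY, Submodule.map_comap_eq, range_restrictScalars_int, LinearMap.ker_restrictScalars, hrange, inf_comm]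
  rw [h2, finrank_map_of_injective _ (show Function.Injective (f.restrictScalars ℤ) from hfinj)] at h1
  omega

/-- **`ℓ_a = rang_ℤ Y_a` is additive.** [cite: RoyWaldschmidt1997ENS, §6 (ii), pp. 786–787] -/
theorem Exact.ellA_add {Xs X X' : RWObj K} (h : Exact Xs X X') : X.ellA = Xs.ellA + X'.ellA := by
  obtain ⟨f, g, ⟨-, hfinj, -, -, hYa⟩, ⟨-, -, -, -, hYa'⟩, hrange⟩ := h
  simp only [RWObj.ellA]
  have h1 := finrank_map_add_finrank_inf_ker_int X.Ya X.fg_Ya (g.restrictScalars ℤ)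
  rw [hYa'] at h1
  have h2 : X.Ya ⊓ LinearMap.ker (g.restrictScalars ℤ) = Xs.Ya.map (f.restrictScalars ℤ) := by
    rw [hYa, Submodule.map_comap_eq, range_restrictScalars_int, LinearMap.ker_restrictScalars, hrange, inf_comm]
  rw [h2, finrank_map_of_injective _ (show Function.Injective (f.restrictScalars ℤ) from hfinj)] at h1
  omega

/-! ### Super-additivity of `n` -/

/-- The span `ℂW + ℂY` is mapped onto `ℂW' + ℂY'` by a cokernel. [folklore] -/
theorem span_map_of_isCoker {X X' : RWObj K} {g} (hg : IsCoker X X' g) :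
    (span ℂ ((X.W : Set ((Fin X.d₀ → ℂ) × (Fin X.d₁ → ℂ))) ∪ (X.Y : Set _))).map g =
      span ℂ ((X'.W : Set ((Fin X'.d₀ → ℂ) × (Fin X'.d₁ → ℂ))) ∪ (X'.Y : Set _)) := by
  obtain ⟨-, -, hW, hY, -⟩ := hg
  rw [Submodule.map_span, Set.image_union]
  congr 2
  · rw [← hW]; rfl
  · rw [← hY]; rfl

/-- **`n = dim_ℂ(ℂW + ℂY)` is super-additive** ("`g` applique surjectivement `ℂW + ℂY` sur
`ℂW' + ℂY'` et le noyau de la restriction de `g` à `ℂW + ℂY` contient l'image de `ℂW* + ℂY*` par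
`f`"). [cite: RoyWaldschmidt1997ENS, §6 (ii), p. 787] -/
theorem Exact.nn_superadd {Xs X X' : RWObj K} (h : Exact Xs X X') : Xs.nn + X'.nn ≤ X.nn := by
  obtain ⟨f, g, ⟨⟨-, hWle, hYle, -⟩, hfinj, -, -, -⟩, hg, hrange⟩ := h
  have hmap := span_map_of_isCoker hg
  simp only [RWObj.nn]
  set S := span ℂ ((X.W : Set ((Fin X.d₀ → ℂ) × (Fin X.d₁ → ℂ))) ∪ (X.Y : Set _)) with hS
  set Ss := span ℂ ((Xs.W : Set ((Fin Xs.d₀ → ℂ) × (Fin Xs.d₁ → ℂ))) ∪ (Xs.Y : Set _)) with hSs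
  have h1 := finrank_map_add_finrank_inf_ker_field S g
  rw [hmap] at h1
  -- `f(Ss) ⊆ S ∩ ker g`
  have h2 : Ss.map f ≤ S ⊓ LinearMap.ker g := by
    refine le_inf ?_ ?_
    · rw [hSs, Submodule.map_span]
      refine span_le.mpr ?_
      rintro _ ⟨p, hp | hp, rfl⟩
      · exact subset_span (Or.inl (hWle ⟨p, hp, rfl⟩))
      · exact subset_span (Or.inr (hYle ⟨p, hp, rfl⟩))
    · rw [← hrange]; exact LinearMap.map_le_range
  have h3 := Submodule.finrank_mono h2
  rw [finrank_map_of_injective _ hfinj] at h3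
  omega

/-! ### Sub-additivity of `κ`, `κ_a` -/

/-- The rational version `0 × ωℚ^{d₁}` of the lattice. [folklore] -/
def omegaLatticeQ (d₀ d₁ : ℕ) : Submodule ℤ ((Fin d₀ → ℂ) × (Fin d₁ → ℂ)) where
  carrier := {p | p.1 = 0 ∧ ∀ j, ∃ q : ℚ, p.2 j = q * (2 * Real.pi * I)}
  add_mem' := by
    rintro p q ⟨hp1, hp2⟩ ⟨hq1, hq2⟩
    refine ⟨by simp [hp1, hq1], fun j => ?_⟩
    obtain ⟨a, ha⟩ := hp2 j; obtain ⟨b, hb⟩ := hq2 j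
    exact ⟨a + b, by simp only [Prod.snd_add, Pi.add_apply, ha, hb]; push_cast; ring⟩
  zero_mem' := ⟨rfl, fun j => ⟨0, by simp⟩⟩
  smul_mem' := by
    rintro c p ⟨hp1, hp2⟩
    refine ⟨by rw [Prod.smul_fst, hp1, smul_zero], fun j => ?_⟩
    obtain ⟨a, ha⟩ := hp2 j
    refine ⟨c * a, ?_⟩
    rw [Prod.smul_snd, Pi.smul_apply, ha, zsmul_eq_mul]
    push_cast; ring

/-- Membership in `0 × ωℚ^{d₁}`. [folklore] -/
theorem mem_omegaLatticeQ {d₀ d₁ : ℕ} {p : (Fin d₀ → ℂ) × (Fin d₁ → ℂ)} :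
    p ∈ omegaLatticeQ d₀ d₁ ↔ p.1 = 0 ∧ ∀ j, ∃ q : ℚ, p.2 j = q * (2 * Real.pi * I) := Iff.rfl

/-- `0 × ωℤ^{d₁} ⊆ 0 × ωℚ^{d₁}`. [folklore] -/
theorem omegaLattice_le_Q (d₀ d₁ : ℕ) : omegaLattice d₀ d₁ ≤ omegaLatticeQ d₀ d₁ := by
  rintro p ⟨hp1, hp2⟩
  refine ⟨hp1, fun j => ?_⟩
  obtain ⟨m, hm⟩ := hp2 j
  exact ⟨m, by rw [hm]; push_cast; rfl⟩

/-- **Saturation**: for a finitely generated subgroup `Z`, `rang_ℤ(Z ∩ (0 × ωℚ^{d₁})) =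
rang_ℤ(Z ∩ (0 × ωℤ^{d₁}))` ("`κ(X) = dim_ℚ(ℚY ∩ (0 × ωℚ^{d₁}))`", p. 787). [folklore] -/
theorem finrank_inf_omegaQ_eq {d₀ d₁ : ℕ} (Z : Submodule ℤ ((Fin d₀ → ℂ) × (Fin d₁ → ℂ))) (hZ : Z.FG) :
    Module.finrank ℤ ↥(Z ⊓ omegaLatticeQ d₀ d₁) = Module.finrank ℤ ↥(Z ⊓ omegaLattice d₀ d₁) := by
  classical
  have hle : Z ⊓ omegaLattice d₀ d₁ ≤ Z ⊓ omegaLatticeQ d₀ d₁ := inf_le_inf_left _ (omegaLattice_le_Q d₀ d₁)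
  haveI : Module.Finite ℤ Z := Module.Finite.iff_fg.mpr hZ
  have hfgQ : (Z ⊓ omegaLatticeQ d₀ d₁).FG := by
    haveI := Module.Finite.of_injective (Submodule.inclusion (inf_le_left : Z ⊓ omegaLatticeQ d₀ d₁ ≤ Z))
      (Submodule.inclusion_injective _)
    exact Module.Finite.iff_fg.mp this
  refine le_antisymm ?_ (finrank_le_of_le_fg hle hfgQ)
  -- a common denominator `N` with `N • (Z ∩ ΩQ) ⊆ Z ∩ Ω`
  obtain ⟨s, hs⟩ := hfgQ
  have hgen : ∀ z ∈ s, z ∈ Z ⊓ omegaLatticeQ d₀ d₁ := fun z hz => by rw [← hs]; exact subset_span hz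
  have hden : ∀ z ∈ (s : Set _), ∃ N : ℕ, 0 < N ∧ (N : ℤ) • z ∈ omegaLattice d₀ d₁ := by
    intro z hz
    obtain ⟨-, hz2⟩ := hgen z hz
    obtain ⟨hz1, hzq⟩ := hz2
    choose q hq using hzq
    obtain ⟨N, hN, hNq⟩ := exists_common_den q
    refine ⟨N, hN, ⟨by rw [Prod.smul_fst, hz1, smul_zero], fun j => ?_⟩⟩
    obtain ⟨m, hm⟩ := hNq j
    refine ⟨m, ?_⟩
    have hc : ((N : ℕ) : ℂ) * ((q j : ℚ) : ℂ) = (m : ℂ) := by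
      have := congrArg (fun x : ℚ => (x : ℂ)) hm; push_cast at this ⊢; exact this
    rw [Prod.smul_snd, Pi.smul_apply, zsmul_eq_mul, hq j, ← mul_assoc, Int.cast_natCast, hc]
  choose! Nf hNf using hden
  set N : ℕ := ∏ z ∈ s, Nf z with hN
  have hNpos : 0 < N := Finset.prod_pos fun z hz => (hNf z hz).1
  have hNmem : ∀ z ∈ Z ⊓ omegaLatticeQ d₀ d₁, (N : ℤ) • z ∈ Z ⊓ omegaLattice d₀ d₁ := by
    intro z hz
    refine ⟨Submodule.smul_mem _ _ hz.1, ?_⟩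
    rw [← hs] at hz
    induction hz using Submodule.span_induction with
    | mem x hx =>
      obtain ⟨-, hx2⟩ := hNf x hx
      have hdvd : (Nf x : ℤ) ∣ (N : ℤ) := by
        rw [hN]; exact_mod_cast Finset.dvd_prod_of_mem Nf hx
      obtain ⟨c, hc⟩ := hdvd
      rw [hc, mul_comm, mul_smul]
      exact Submodule.smul_mem _ _ hx2
    | zero => simp
    | add x y _ _ hx hy => rw [smul_add]; exact Submodule.add_mem _ hx hy
    | smul c x _ hx => rw [smul_comm]; exact Submodule.smul_mem _ _ hx
  -- the injective map `z ↦ N • z`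
  let φ : ↥(Z ⊓ omegaLatticeQ d₀ d₁) →ₗ[ℤ] ↥(Z ⊓ omegaLattice d₀ d₁) :=
    { toFun := fun z => ⟨(N : ℤ) • (z : (Fin d₀ → ℂ) × (Fin d₁ → ℂ)), hNmem z z.2⟩
      map_add' := fun z w => by
        apply Subtype.ext
        show (N : ℤ) • ((z : (Fin d₀ → ℂ) × (Fin d₁ → ℂ)) + w) = (N : ℤ) • (z : _) + (N : ℤ) • (w : _)
        exact smul_add _ _ _
      map_smul' := fun c z => by
        apply Subtype.ext
        show (N : ℤ) • (c • (z : (Fin d₀ → ℂ) × (Fin d₁ → ℂ))) = c • ((N : ℤ) • (z : _))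
        exact smul_comm _ _ _ }
  have hφ : Function.Injective φ := by
    intro z w hzw
    have : (N : ℤ) • (z : (Fin d₀ → ℂ) × (Fin d₁ → ℂ)) = (N : ℤ) • (w : _) := congrArg Subtype.val hzw
    exact Subtype.ext (smul_right_injective _ (by exact_mod_cast hNpos.ne') this)
  haveI : Module.Finite ℤ ↥(Z ⊓ omegaLattice d₀ d₁) :=
    Module.Finite.of_injective (Submodule.inclusion (inf_le_left : Z ⊓ omegaLattice d₀ d₁ ≤ Z))
      (Submodule.inclusion_injective _)
  exact LinearMap.finrank_le_finrank_of_injective hφ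

/-- The common core of the sub-additivity of `κ` and `κ_a`: for an exact triple in block form
with `f₁, g₁` defined over `ℚ`, and `ℤ`-submodules `Zs = f⁻¹Z`, `Z' = gZ`,
`rang(Z ∩ ΩQ) ≤ rang(Zs ∩ ΩQs) + rang(Z' ∩ ΩQ')` ("`g` applique `ℚY ∩ (0 × ωℚ^{d₁})` dans
`ℚY' ∩ (0 × ωℚ^{d₁'})` et le noyau … coïncide avec l'image de `ℚY* ∩ (0 × ωℚ^{d₁*})`", p. 787).
[cite: RoyWaldschmidt1997ENS, §6 (ii), p. 787] -/
theorem finrank_inf_omegaQ_subadd {d₀s d₁s d₀ d₁ d₀' d₁' : ℕ}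
    {f : ((Fin d₀s → ℂ) × (Fin d₁s → ℂ)) →ₗ[ℂ] ((Fin d₀ → ℂ) × (Fin d₁ → ℂ))}
    {g : ((Fin d₀ → ℂ) × (Fin d₁ → ℂ)) →ₗ[ℂ] ((Fin d₀' → ℂ) × (Fin d₁' → ℂ))}
    {f₀ : (Fin d₀s → ℂ) →ₗ[ℂ] (Fin d₀ → ℂ)} {f₁ : (Fin d₁s → ℂ) →ₗ[ℂ] (Fin d₁ → ℂ)}
    {g₀ : (Fin d₀ → ℂ) →ₗ[ℂ] (Fin d₀' → ℂ)} {g₁ : (Fin d₁ → ℂ) →ₗ[ℂ] (Fin d₁' → ℂ)}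
    (hfap : ∀ p, f p = (f₀ p.1, f₁ p.2)) (hgap : ∀ p, g p = (g₀ p.1, g₁ p.2))
    {f₁₀ : (Fin d₁s → ℚ) →ₗ[ℚ] (Fin d₁ → ℚ)} {g₁₀ : (Fin d₁ → ℚ) →ₗ[ℚ] (Fin d₁' → ℚ)}
    (hf₁₀ : ∀ q : Fin d₁s → ℚ, f₁ (fun j => ((q j : ℚ) : ℂ)) = fun i => ((f₁₀ q i : ℚ) : ℂ))
    (hg₁₀ : ∀ q : Fin d₁ → ℚ, g₁ (fun j => ((q j : ℚ) : ℂ)) = fun i => ((g₁₀ q i : ℚ) : ℂ))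
    (hfinj : Function.Injective f) (hrange : LinearMap.range f = LinearMap.ker g)
    (Z : Submodule ℤ ((Fin d₀ → ℂ) × (Fin d₁ → ℂ))) (Zs : Submodule ℤ ((Fin d₀s → ℂ) × (Fin d₁s → ℂ)))
    (Z' : Submodule ℤ ((Fin d₀' → ℂ) × (Fin d₁' → ℂ))) (hZ : Z.FG) (hZs : Zs.FG) (hZ' : Z'.FG)
    (hcomap : Zs = Z.comap (f.restrictScalars ℤ)) (hmap : Z.map (g.restrictScalars ℤ) = Z') :
    Module.finrank ℤ ↥(Z ⊓ omegaLatticeQ d₀ d₁) ≤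
      Module.finrank ℤ ↥(Zs ⊓ omegaLatticeQ d₀s d₁s) + Module.finrank ℤ ↥(Z' ⊓ omegaLatticeQ d₀' d₁') := by
  classical
  obtain ⟨hf₀inj, hf₁inj⟩ := block_injective hfap hfinj
  set T := Z ⊓ omegaLatticeQ d₀ d₁ with hT
  have hTfg : T.FG := by
    haveI : Module.Finite ℤ Z := Module.Finite.iff_fg.mpr hZ
    haveI := Module.Finite.of_injective (Submodule.inclusion (inf_le_left : T ≤ Z)) (Submodule.inclusion_injective _)
    exact Module.Finite.iff_fg.mp this
  have h1 := finrank_map_add_finrank_inf_ker_int T hTfg (g.restrictScalars ℤ)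
  have h2pi : (2 * Real.pi * I : ℂ) ≠ 0 := by simp [Real.pi_ne_zero, I_ne_zero]
  -- image ⊆ Z' ∩ ΩQ'
  have himage : T.map (g.restrictScalars ℤ) ≤ Z' ⊓ omegaLatticeQ d₀' d₁' := by
    rintro _ ⟨p, ⟨hpZ, hp1, hp2⟩, rfl⟩
    refine ⟨?_, ?_, fun i => ?_⟩
    · rw [← hmap]; exact ⟨p, hpZ, rfl⟩
    · show (g p).1 = 0
      rw [hgap]; simp [hp1]
    · show ∃ q : ℚ, (g p).2 i = q * (2 * Real.pi * I)
      choose q hq using hp2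
      have hp2' : p.2 = (2 * Real.pi * I : ℂ) • fun j => ((q j : ℚ) : ℂ) := by
        funext j; rw [hq j, Pi.smul_apply, smul_eq_mul, mul_comm]
      refine ⟨g₁₀ q i, ?_⟩
      rw [hgap]; simp only
      rw [hp2', map_smul, hg₁₀, Pi.smul_apply, smul_eq_mul, mul_comm]
  -- kernel ⊆ f(Zs ∩ ΩQs)
  have hkernel : T ⊓ LinearMap.ker (g.restrictScalars ℤ) ≤ (Zs ⊓ omegaLatticeQ d₀s d₁s).map (f.restrictScalars ℤ) := by
    rintro p ⟨⟨hpZ, hp1, hp2⟩, hpker⟩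
    have hpker' : p ∈ LinearMap.range f := by rw [hrange]; exact hpker
    obtain ⟨ps, rfl⟩ := hpker'
    refine ⟨ps, ⟨?_, ?_, fun j => ?_⟩, rfl⟩
    · rw [hcomap]; exact hpZ
    · rw [hfap] at hp1
      exact hf₀inj (by simpa using hp1)
    · choose q hq using hp2
      have hp2' : f₁ ps.2 = (2 * Real.pi * I : ℂ) • fun j => ((q j : ℚ) : ℂ) := by
        funext j
        have := hq j; rw [hfap] at this
        rw [Pi.smul_apply, smul_eq_mul, mul_comm]; exact this
      have hx : f₁ ((2 * Real.pi * I : ℂ)⁻¹ • ps.2) = fun j => ((q j : ℚ) : ℂ) := by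
        rw [map_smul, hp2', smul_smul, inv_mul_cancel₀ h2pi, one_smul]
      obtain ⟨v, hv⟩ := rat_descent f₁ f₁₀ hf₁₀ hf₁inj hx
      refine ⟨v j, ?_⟩
      have := congrFun hv j
      simp only [Pi.smul_apply, smul_eq_mul] at this
      rw [show ps.2 j = (2 * Real.pi * I : ℂ) * ((2 * Real.pi * I : ℂ)⁻¹ * ps.2 j) from by
        rw [← mul_assoc, mul_inv_cancel₀ h2pi, one_mul], this, mul_comm]
  -- count
  have h3 : Module.finrank ℤ ↥(T.map (g.restrictScalars ℤ)) ≤ Module.finrank ℤ ↥(Z' ⊓ omegaLatticeQ d₀' d₁') := by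
    refine finrank_le_of_le_fg himage ?_
    haveI : Module.Finite ℤ Z' := Module.Finite.iff_fg.mpr hZ'
    haveI := Module.Finite.of_injective (Submodule.inclusion (inf_le_left : Z' ⊓ omegaLatticeQ d₀' d₁' ≤ Z'))
      (Submodule.inclusion_injective _)
    exact Module.Finite.iff_fg.mp this
  have h4 : Module.finrank ℤ ↥(T ⊓ LinearMap.ker (g.restrictScalars ℤ)) ≤
      Module.finrank ℤ ↥(Zs ⊓ omegaLatticeQ d₀s d₁s) := by
    have hfgs : (Zs ⊓ omegaLatticeQ d₀s d₁s).FG := by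
      haveI : Module.Finite ℤ Zs := Module.Finite.iff_fg.mpr hZs
      haveI := Module.Finite.of_injective (Submodule.inclusion (inf_le_left : Zs ⊓ omegaLatticeQ d₀s d₁s ≤ Zs))
        (Submodule.inclusion_injective _)
      exact Module.Finite.iff_fg.mp this
    refine (finrank_le_of_le_fg hkernel (hfgs.map _)).trans ?_
    rw [finrank_map_of_injective _ (show Function.Injective (f.restrictScalars ℤ) from hfinj)]
  omega

/-- **`κ` is sub-additive on exact triples.** [cite: RoyWaldschmidt1997ENS, §6 (ii), p. 787] -/
theorem Exact.kap_subadd {Xs X X' : RWObj K} (h : Exact Xs X X') : X.kap ≤ Xs.kap + X'.kap := by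
  obtain ⟨f, g, ⟨⟨hfs, -, -, -⟩, hfinj, -, hY, -⟩, ⟨⟨hgs, -, -, -⟩, -, -, hY', -⟩, hrange⟩ := h
  obtain ⟨f₀, f₁, f₀K, f₁₀, hfap, -, hf₁₀⟩ := hfs.exists_block
  obtain ⟨g₀, g₁, g₀K, g₁₀, hgap, -, hg₁₀⟩ := hgs.exists_block
  simp only [RWObj.kap]
  rw [← finrank_inf_omegaQ_eq X.Y X.hYfg, ← finrank_inf_omegaQ_eq Xs.Y Xs.hYfg, ← finrank_inf_omegaQ_eq X'.Y X'.hYfg]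
  exact finrank_inf_omegaQ_subadd hfap hgap hf₁₀ hg₁₀ hfinj hrange X.Y Xs.Y X'.Y X.hYfg Xs.hYfg X'.hYfg hY hY'

/-- **`κ_a` is sub-additive on exact triples.** [cite: RoyWaldschmidt1997ENS, §6 (ii), p. 787] -/
theorem Exact.kapA_subadd {Xs X X' : RWObj K} (h : Exact Xs X X') : X.kapA ≤ Xs.kapA + X'.kapA := by
  obtain ⟨f, g, ⟨⟨hfs, -, -, -⟩, hfinj, -, -, hYa⟩, ⟨⟨hgs, -, -, -⟩, -, -, -, hYa'⟩, hrange⟩ := h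
  obtain ⟨f₀, f₁, f₀K, f₁₀, hfap, -, hf₁₀⟩ := hfs.exists_block
  obtain ⟨g₀, g₁, g₀K, g₁₀, hgap, -, hg₁₀⟩ := hgs.exists_block
  simp only [RWObj.kapA]
  rw [← finrank_inf_omegaQ_eq X.Ya X.fg_Ya, ← finrank_inf_omegaQ_eq Xs.Ya Xs.fg_Ya, ← finrank_inf_omegaQ_eq X'.Ya X'.fg_Ya]
  exact finrank_inf_omegaQ_subadd hfap hgap hf₁₀ hg₁₀ hfinj hrange X.Ya Xs.Ya X'.Ya X.fg_Ya Xs.fg_Ya X'.fg_Ya hYa hYa'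

/-! ### Elementary bounds -/

namespace RWObj

/-- `κ_a ≤ κ`. [folklore] -/
theorem kapA_le_kap (X : RWObj K) : X.kapA ≤ X.kap := by
  simp only [kapA, kap]
  refine finrank_le_of_le_fg (inf_le_inf_right _ X.hYa) ?_
  haveI := X.finite_Y
  haveI := Module.Finite.of_injective (Submodule.inclusion (inf_le_left : X.Y ⊓ omegaLattice X.d₀ X.d₁ ≤ X.Y))
    (Submodule.inclusion_injective _)
  exact Module.Finite.iff_fg.mp this

/-- `κ ≤ ℓ₁`. [folklore] -/
theorem kap_le_ell₁ (X : RWObj K) : X.kap ≤ X.ell₁ := by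
  simp only [kap, ell₁]
  exact finrank_le_of_le_fg inf_le_left X.hYfg

/-- `ℓ_a ≤ ℓ₁`. [folklore] -/
theorem ellA_le_ell₁ (X : RWObj K) : X.ellA ≤ X.ell₁ := by
  simp only [ellA, ell₁]
  exact finrank_le_of_le_fg X.hYa X.hYfg

/-- The lattice `0 × ωℤ^{d₁}` is finitely generated of rank `d₁`. [folklore] -/
theorem omegaLattice_fg_finrank (d₀ d₁ : ℕ) :
    (omegaLattice d₀ d₁).FG ∧ Module.finrank ℤ ↥(omegaLattice d₀ d₁) = d₁ := by
  -- `Ω` is the injective image of `ℤ^{d₁}` under `z ↦ (0, ω z)`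
  let ψ : (Fin d₁ → ℤ) →ₗ[ℤ] ((Fin d₀ → ℂ) × (Fin d₁ → ℂ)) :=
    { toFun := fun z => (0, fun j => (z j : ℂ) * (2 * Real.pi * I))
      map_add' := fun z w => by ext j <;> simp [add_mul]
      map_smul' := fun c z => by ext j <;> simp [mul_assoc] }
  have hψ : Function.Injective ψ := by
    intro z w h
    have h2 := congrArg Prod.snd h
    funext j
    have := congrFun h2 j
    have h2pi : (2 * Real.pi * I : ℂ) ≠ 0 := by simp [Real.pi_ne_zero, I_ne_zero]
    have := mul_right_cancel₀ h2pi this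
    exact_mod_cast this
  have hrange : LinearMap.range ψ = omegaLattice d₀ d₁ := by
    ext p
    rw [LinearMap.mem_range, mem_omegaLattice]
    constructor
    · rintro ⟨z, rfl⟩; exact ⟨rfl, fun j => ⟨z j, rfl⟩⟩
    · rintro ⟨hp1, hp2⟩
      choose m hm using hp2
      refine ⟨m, ?_⟩
      ext j
      · show (0 : Fin d₀ → ℂ) j = p.1 j
        rw [hp1]
      · show (m j : ℂ) * (2 * Real.pi * I) = p.2 j
        rw [hm j]
  rw [← hrange, ← Submodule.map_top]
  refine ⟨(Module.Finite.fg_top).map _, ?_⟩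
  rw [finrank_map_of_injective ψ hψ, finrank_top, Module.finrank_fin_fun]

/-- `κ ≤ d₁`. [folklore] -/
theorem kap_le_dd₁ (X : RWObj K) : X.kap ≤ X.dd₁ := by
  simp only [kap, dd₁]
  obtain ⟨hfg, hfr⟩ := omegaLattice_fg_finrank X.d₀ X.d₁
  exact (finrank_le_of_le_fg inf_le_right hfg).trans hfr.le

/-- `n ≤ d`. [folklore] -/
theorem nn_le_dd (X : RWObj K) : X.nn ≤ X.dd := by
  simp only [nn, dd]
  have := Submodule.finrank_le (span ℂ ((X.W : Set ((Fin X.d₀ → ℂ) × (Fin X.d₁ → ℂ))) ∪ (X.Y : Set _)))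
  simpa [Module.finrank_prod, Module.finrank_fin_fun] using this

/-- `n = 0 ⟹ ℓ₁ = 0` (then `Y = 0`). [folklore] -/
theorem ell₁_eq_zero_of_nn (X : RWObj K) (h : X.nn = 0) : X.ell₁ = 0 := by
  simp only [nn, ell₁] at *
  have hbot : span ℂ ((X.W : Set ((Fin X.d₀ → ℂ) × (Fin X.d₁ → ℂ))) ∪ (X.Y : Set _)) = ⊥ :=
    Submodule.finrank_eq_zero.mp h
  have hY : X.Y = ⊥ := by
    rw [eq_bot_iff]
    intro y hy
    have : y ∈ span ℂ ((X.W : Set ((Fin X.d₀ → ℂ) × (Fin X.d₁ → ℂ))) ∪ (X.Y : Set _)) := subset_span (Or.inr hy)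
    rw [hbot] at this
    exact this
  rw [hY, finrank_bot]

/-- `n = 0 ⟹ ℓ_a = 0`. [folklore] -/
theorem ellA_eq_zero_of_nn (X : RWObj K) (h : X.nn = 0) : X.ellA = 0 := by
  have := X.ellA_le_ell₁; rw [X.ell₁_eq_zero_of_nn h] at this; omega

/-- `n = 0 ⟹ κ_a = 0`. [folklore] -/
theorem kapA_eq_zero_of_nn (X : RWObj K) (h : X.nn = 0) : X.kapA = 0 := by
  have := (X.kapA_le_kap).trans X.kap_le_ell₁; rw [X.ell₁_eq_zero_of_nn h] at this; omega

set_option synthInstance.maxHeartbeats 200000 in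
/-- **`ℓ₀ ≤ n`**: a `K`-basis of `W ⊆ K^d` is `ℂ`-linearly independent. [folklore] -/
theorem ell₀_le_nn (X : RWObj K) : X.ell₀ ≤ X.nn := by
  classical
  simp only [ell₀, nn]
  haveI := X.finite_W
  haveI : Module.Free K X.W := Module.Free.of_divisionRing K X.W
  -- transport to the function space `Fin d₀ ⊕ Fin d₁ → ℂ`
  let e : ((Fin X.d₀ → ℂ) × (Fin X.d₁ → ℂ)) ≃ₗ[ℂ] (Fin X.d₀ ⊕ Fin X.d₁ → ℂ) :=
    (LinearEquiv.sumArrowLequivProdArrow (Fin X.d₀) (Fin X.d₁) ℂ ℂ).symm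
  set m := Module.finrank K X.W with hm
  let b : Basis (Fin m) K X.W := Module.finBasis K X.W
  have he1 : ∀ (v : (Fin X.d₀ → ℂ) × (Fin X.d₁ → ℂ)) x, e v (Sum.inl x) = v.1 x := fun _ _ => rfl
  have he2 : ∀ (v : (Fin X.d₀ → ℂ) × (Fin X.d₁ → ℂ)) x, e v (Sum.inr x) = v.2 x := fun _ _ => rfl
  have hcoord : ∀ i (x : Fin X.d₀ ⊕ Fin X.d₁), e (b i : (Fin X.d₀ → ℂ) × (Fin X.d₁ → ℂ)) x ∈ K := by
    intro i x
    obtain ⟨h1, h2⟩ := X.hW _ (b i).2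
    cases x with
    | inl x => rw [he1]; exact h1 x
    | inr x => rw [he2]; exact h2 x
  let u : Fin m → (Fin X.d₀ ⊕ Fin X.d₁) → K := fun i x => ⟨e (b i : (Fin X.d₀ → ℂ) × (Fin X.d₁ → ℂ)) x, hcoord i x⟩
  have hu : ∀ i, ofK K (L := ℂ) (u i) = e (b i : (Fin X.d₀ → ℂ) × (Fin X.d₁ → ℂ)) := fun i => funext fun x => rfl
  -- `e` of a `K`-combination of the `b i` is `ofK` of the `K`-combination of the `u i`
  have hcomb : ∀ c : Fin m → K, e ((∑ i, c i • b i : X.W) : (Fin X.d₀ → ℂ) × (Fin X.d₁ → ℂ)) =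
      ofK K (L := ℂ) (∑ i, c i • u i) := by
    intro c
    rw [Submodule.coe_sum, map_sum, ofK_sum_smul]
    refine Finset.sum_congr rfl fun i _ => ?_
    rw [Submodule.coe_smul, IntermediateField.smul_def, map_smul, ← hu i]
    rfl
  -- `K`-independence of the `u i`
  have hli : LinearIndependent K u := by
    rw [Fintype.linearIndependent_iff]
    intro c hc
    have hb := (Fintype.linearIndependent_iff.mp b.linearIndependent) c
    apply hb
    rw [← Submodule.coe_eq_zero]
    apply e.injective
    rw [hcomb, hc, map_zero]
    funext x; simp [ofK_apply]
  -- `ℂ`-independence of the `ofK (u i)`, hence the bound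
  have hdim : Module.finrank ℂ (span ℂ (Set.range (ofK K (L := ℂ) ∘ u))) = m := by
    have h1 := finrank_span_ofK (K := K) (L := ℂ) (span K (Set.range u))
    rw [span_ofK_span, ← Set.range_comp] at h1
    rw [h1, finrank_span_eq_card hli, Fintype.card_fin]
  have hsub : span ℂ (Set.range (ofK K (L := ℂ) ∘ u)) ≤
      (span ℂ ((X.W : Set ((Fin X.d₀ → ℂ) × (Fin X.d₁ → ℂ))) ∪ (X.Y : Set _))).map e.toLinearMap := by
    refine span_le.mpr ?_
    rintro _ ⟨i, rfl⟩
    show ofK K (L := ℂ) (u i) ∈ _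
    rw [hu i]
    exact ⟨b i, subset_span (Or.inl (b i).2), rfl⟩
  have := Submodule.finrank_mono hsub
  rw [hdim, LinearEquiv.finrank_map_eq] at this
  exact this

end RWObj

end RoyWaldschmidt1997

end Literature.NumberTheory.Transcendental
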